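import Summits.QuantumFields.YangMills.Theorems.BalabanUVNodesN21AtSRec13CoPSelected
import Summits.QuantumFields.YangMills.Theorems.BalabanUVNodesN27AtRecord13CoPHome

/-!
«CoP» EDITION (director-ym №152 RULING (β) + node00-def-T KEY-RULE-21: RECORD 13 re-based on print's background `UbgMSCoOfRecord`; the K3 spine ∕ rate homes re-keyed on the
UNCHANGED background-free `θ.Provisos₁₃Core F N` with the datum `datumOfRecord₁₃CoP` and record class `IsRecordOfRecord₁₃CCoP` — dag-n27-c's `…SpineCarriersOfRecord13CoP` for the n20 lineage,
dag-n22-e's `…RateCarriersOfRecord13CoP`, node00-def-RR-2's `Node00.Record13DatumKeyCoP`) of this seat's module 21c (‴ edition p496248, g5); the ‴ (stmt-QuantumFields-19912) and ⁗-`Sep`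
editions stay in the tree as aside-lane attachments.  STATEMENTS = the ‴ statements under the token map `Provisos₁₃ ↦ Provisos₁₃Core`, `datumOfRecord₁₃ ↦ datumOfRecord₁₃CoP`,
`Is∕isDatumOfRecord₁₃C ↦ …CCoP`, `IsRecordOfRecord₁₃C ↦ …CCoP`, `RateReading₁₃ ∕ rateCarriersOfRecord₁₃ ∕ RRec₁₃(On) ∕ readingOfRecord₁₃ ↦ …₁₃CoP…`, `SpineReading₁₃ ∕ SRec₁₃(On) ∕ sRec₁₃ ∕ keyed₁₃
∕ homes₁₃ ∕ rec13C ↦ …CoP…`; PROOFS VERBATIM; θ-only declarations NOT renamed.  `--kind proof --supports <K3 id of record> --as helper`.  Generated by this seat's `sep/gen.py`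
(`SEP_SUFFIX=CoP SEP_PROVISOS_SUFFIX=Core`).

# YM-DAG node N21 (= NE7c) — THE COMPOSITE KNIT AT THE STAGE-13 HOMES WITH N21 IN THE ∃-WEIGHT CURRENCY: dag-n27-c's `spine_rec13CCoP_of_homes₁₃CoP` (module XXXVIII) with
# `h21 : S_N21 (SRec₁₃CoP cr)` REPLACED by «for every admissible Stage-13 tuple with provisos and every `(g₀, os)`, SOME weight `Wsh` with `ShellWeightBound (cr …) … Wsh`» —
# the ₁₃ twin of module 9 §4, fed on the selection road by module 21b's three faces (one application each)

Track A of `YM-PLAN.md` (cell `pub-ymgap`, HUMAN RULING D-0062), node **N21**; R134 fan-out seat `pub-ymgap-dag-n21-d` (s2 = BY-NAME KNIT at the record), generation 5, module 21c.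
THEOREMS ONLY: 0 `def`, 0 `sorry`, standard axioms; COUNT-NEUTRAL; `--supports` the K3⁗ item `SpineGivenEndpointR13Sep` (stmt-QuantumFields-20292) as a helper.  `N`-generic, NO Theses
import (restate-immune).  Imports module 21b `BalabanUVNodesN21AtSRec13CoPSelected` (p494903; brings 21a p494514: `exists_reweight_s_N21_sRec₁₃CoP`, `s_N27x_sRec₁₃CoP_reweight_iff`,
`s_N20_sRec₁₃CoP_reweight_iff`, `coreEdge₁₃CoP_reweight`, and 21b's `…keyed₁₃CoP_of_selected*` faces) and dag-n27-c's XXXVIII `BalabanUVNodesN27AtRecord13CoPHome` (p494468: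
`spine_rec13CCoP_of_homes₁₃CoP` over dag-n20-d's `SRec₁₃CoP` and dag-n22-e's `RRec₁₃CoP`).  Restates nothing; cites by name.

WHAT IS PROVED ([bookkeeping]; each step ONE application BY NAME).
* §1 `spine_rec13CCoP_of_homes₁₃CoP_existsShellWeight` — XXXVIII's `spine_rec13CCoP_of_homes₁₃CoP` (six K4 stubs at `RRec₁₃CoP 𝔯`, `S_N27x ₁₃C`, `S_N20` at `SRec₁₃CoP cr`, the home-keyed N19′
  edge `h19`) with `h21` REPLACED by the ∃-weight certificate: the reading is re-weighted by 21a §3, the other binders transferred by 21a §2, and the conclusion `Spine ₁₃C` does not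
  mention the reading; `spine_rec13CCoP_of_homes₁₃CoP_faces_existsShellWeight` (the θ-indexed faces form, XXXVIII `…_faces` with `h21` in the ∃-weight currency).
* §2 (docstring plugs, not re-declared): on the selection road the ∃-weight certificate `hW` is ONE application of module 21b — `fun F θ hP hθ g₀ os => by obtain ⟨…, hSW⟩ :=
  N21AtSRec13CoPSelected.levelLedgers_shellWeightBound_keyed₁₃CoP_of_selectedSharp cr hsel F θ hP hθ g₀ os; exact ⟨_, hSW⟩` (sharp letters), or `… shellWeightBound_keyed₁₃CoP_of_selectedTransport
  cr htr …` (ROW A‴ transported masses), or `… shellWeightBound_keyed₁₃CoP_of_selectedHistories cr hhist …` (history letters) — so the K3‴ composite at the homes reads N21 through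
  whichever package NODE O's term object delivers, with NO clause on the reading's weight slot.

HONEST FRAMING (binding).  Bookkeeping by name: every K4 ∕ K5 stub and the N19′ edge are HYPOTHESES with NO producer at any record today (0∕1); the readings `cr`, `𝔯` are PARAMETERS
(no reading of Bałaban's dressed two-run expansion exists in the tree); no inhabitant of `Node00.IsRecordOfRecord₁₃CCoP` claimed (K0‴ open); nothing of Bałaban's asserted; NE7 ∕
NE7b ∕ NE7c NOT PRINTED for d = 4 and NOT PROVED; **N21 NOT discharged**, N27 NOT discharged, K3‴ NOT claimed; typed 28∕28, discharged count untouched; one finite four-torus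
programme at fixed `ε` — NOT ℝ⁴, NOT infinite volume, NOT OS, NOT a mass gap, NOT Clay.  No decl below carries a cite tag.
-/

set_option autoImplicit false

open Finset

namespace Summit.QuantumFields.YangMills.Theorems.N21AtSRec13CoPWeightHomes

open Literature.MathematicalPhysics.QuantumFieldTheory.Balaban1983to89
open Literature.MathematicalPhysics.QuantumFieldTheory.Balaban1983to89.T4Continuum (T4Family ULoop)
open T4WeightBudget (RelWeightBound)
open T4IndicatorShell (ShellWeightBound)
open Summit.QuantumFields.BalabanUV.T4Continuum.Spine
open YMDAG.UVSplit
open Node00 (Stage13Params datumOfRecord₁₃CoP IsRecordOfRecord₁₃CCoP IsDatumOfRecord₁₃CCoP)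
open BalabanUVNodesN27SpineRecord (spine_rec13CCoP_of_homes₁₃CoP)
open N21AtSRec13CoPWeight (exists_reweight_s_N21_sRec₁₃CoP s_N27x_sRec₁₃CoP_reweight_iff s_N20_sRec₁₃CoP_reweight_iff coreEdge₁₃CoP_reweight)

variable {N : ℕ} [NeZero N] (cr : SpineReading₁₃CoP N)

/-! ## §1 The composite knit at the Stage-13 homes with N21 in the ∃-weight currency -/

/-- **N27 = B5 AT THE STAGE-13 RECORD FROM THE HOMES, N21 SUPPLIED AS AN ∃-WEIGHT CERTIFICATE.**  dag-n27-c XXXVIII's `spine_rec13CCoP_of_homes₁₃CoP` — the six K4 stubs at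
`RRec₁₃CoP 𝔯`, `S_N27x ₁₃C (SRec₁₃CoP cr)`, `S_N20 (SRec₁₃CoP cr)` and the home-keyed N19′ edge `h19` — with `h21 : S_N21 (SRec₁₃CoP cr)` REPLACED by «for every admissible Stage-13 tuple
with provisos and every `(g₀, os)`, SOME weight `Wsh` with `ShellWeightBound (cr …) … Wsh»: the reading is re-weighted by 21a's `exists_reweight_s_N21_sRec₁₃CoP`, the other binders
transferred by 21a §2 (`s_N27x_sRec₁₃CoP_reweight_iff`, `s_N20_sRec₁₃CoP_reweight_iff`, `coreEdge₁₃CoP_reweight`), and the conclusion `Spine ₁₃C` does not mention the reading.  On the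
selection road `hW` is ONE application of module 21b (see the file header).  Every binder a HYPOTHESIS (0∕1 today); N21 ∕ N27 NOT discharged; K3‴ NOT claimed. [bookkeeping] -/
theorem spine_rec13CCoP_of_homes₁₃CoP_existsShellWeight (𝔯 : RateReading₁₃CoP N) (h14 : S_N14 (RRec₁₃CoP 𝔯)) (h15 : S_N15 (RRec₁₃CoP 𝔯)) (h16 : S_N16 (RRec₁₃CoP 𝔯))
    (h17 : S_N17 (RRec₁₃CoP 𝔯)) (h18 : S_N18 (RRec₁₃CoP 𝔯)) (h22 : S_N22 (RRec₁₃CoP 𝔯)) (hx' : S_N27x (fun F D w => IsRecordOfRecord₁₃CCoP F N D w) (SRec₁₃CoP cr))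
    (h20 : S_N20 (SRec₁₃CoP cr))
    (hW : ∀ (F : T4Family) (θ : Stage13Params F N) (hP : θ.Provisos₁₃Core F N), θ.Admissible F N → ∀ (g₀ : ℕ → ℝ) (os : List (ULoop F)),
      ∃ Wsh : ℕ → ℝ, ShellWeightBound (cr F θ hP g₀ os).l₀ (cr F θ hP g₀ os).T (cr F θ hP g₀ os).A (cr F θ hP g₀ os).B (cr F θ hP g₀ os).shA
        (cr F θ hP g₀ os).shB Wsh)
    (h19 : ∀ (F : T4Family) (θ : Stage13Params F N) (hP : θ.Provisos₁₃Core F N), θ.Admissible F N → ∀ (g₀ : ℕ → ℝ) (os : List (ULoop F))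
      (h : IsDatumOfRecord₁₃CCoP F N (datumOfRecord₁₃CoP F N θ hP)) (k : ℕ),
      RatesAt (datumOfRecord₁₃CoP F N θ hP) (rateCarriersOfRecord₁₃CoP 𝔯 F h.params h.provisos g₀ os k) → letI := (cr F θ hP g₀ os).dec
        ∃ δ : ℕ → ℝ, NE7.Core (cr F θ hP g₀ os).l₀ (cr F θ hP g₀ os).vol (cr F θ hP g₀ os).T (cr F θ hP g₀ os).Bad
          (fun K t τ => (cr F θ hP g₀ os).A K t τ - (cr F θ hP g₀ os).shA K t τ) (fun K t τ => (cr F θ hP g₀ os).B K t τ - (cr F θ hP g₀ os).shB K t τ) δ ∧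
          Summable δ) :
    Spine (N := N) fun F D w => IsRecordOfRecord₁₃CCoP F N D w := by
  obtain ⟨w, h21⟩ := exists_reweight_s_N21_sRec₁₃CoP cr hW
  exact spine_rec13CCoP_of_homes₁₃CoP (fun F θ hP g₀ os => { cr F θ hP g₀ os with Wsh := w F θ hP g₀ os }) 𝔯 h14 h15 h16 h17 h18 h22
    ((s_N27x_sRec₁₃CoP_reweight_iff cr w _).2 hx') ((s_N20_sRec₁₃CoP_reweight_iff cr w).2 h20) h21 (coreEdge₁₃CoP_reweight cr w 𝔯 h19)

/-- **THE SAME WITH THE SPINE-SIDE STUBS READ THROUGH THE HOME's FACES** (XXXVIII `spine_rec13CCoP_of_homes₁₃CoP_faces` with `h21` in the ∃-weight currency): N27x's unconditional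
θ-form, N20 `RelWeightBound (cr …)` and «∃ Wsh, ShellWeightBound (cr …) … Wsh» at every admissible Stage-13 tuple with provisos, the six rate stubs and the home-keyed edge ⇒
`Spine ₁₃C`. [bookkeeping] -/
theorem spine_rec13CCoP_of_homes₁₃CoP_faces_existsShellWeight (𝔯 : RateReading₁₃CoP N) (h14 : S_N14 (RRec₁₃CoP 𝔯)) (h15 : S_N15 (RRec₁₃CoP 𝔯)) (h16 : S_N16 (RRec₁₃CoP 𝔯))
    (h17 : S_N17 (RRec₁₃CoP 𝔯)) (h18 : S_N18 (RRec₁₃CoP 𝔯)) (h22 : S_N22 (RRec₁₃CoP 𝔯))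
    (hx : ∀ (F : T4Family) (θ : Stage13Params F N) (hP : θ.Provisos₁₃Core F N), θ.Admissible F N → ∀ (g₀ : ℕ → ℝ) (os : List (ULoop F)),
      0 < (cr F θ hP g₀ os).l₀ ∧ 0 < (cr F θ hP g₀ os).vol ∧
        (∀ (K : ℕ) (t : ℝ), |t| ≤ (cr F θ hP g₀ os).l₀ →
          T4GenFunBounds.schemeZ ((datumOfRecord₁₃CoP F N θ hP).scheme g₀) os ((cr F θ hP g₀ os).K₀ + K) t =
            ∑ τ ∈ (cr F θ hP g₀ os).T K, (cr F θ hP g₀ os).A K t τ) ∧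
        (∀ (K : ℕ) (t : ℝ), |t| ≤ (cr F θ hP g₀ os).l₀ →
          T4GenFunBounds.schemeZ ((datumOfRecord₁₃CoP F N θ hP).scheme g₀) os ((cr F θ hP g₀ os).K₀ + K + 1) t =
            ∑ τ ∈ (cr F θ hP g₀ os).T K, (cr F θ hP g₀ os).B K t τ))
    (h20 : ∀ (F : T4Family) (θ : Stage13Params F N) (hP : θ.Provisos₁₃Core F N), θ.Admissible F N → ∀ (g₀ : ℕ → ℝ) (os : List (ULoop F)),
      RelWeightBound (cr F θ hP g₀ os).l₀ (cr F θ hP g₀ os).T (cr F θ hP g₀ os).A (cr F θ hP g₀ os).B (cr F θ hP g₀ os).Bad (cr F θ hP g₀ os).W)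
    (hW : ∀ (F : T4Family) (θ : Stage13Params F N) (hP : θ.Provisos₁₃Core F N), θ.Admissible F N → ∀ (g₀ : ℕ → ℝ) (os : List (ULoop F)),
      ∃ Wsh : ℕ → ℝ, ShellWeightBound (cr F θ hP g₀ os).l₀ (cr F θ hP g₀ os).T (cr F θ hP g₀ os).A (cr F θ hP g₀ os).B (cr F θ hP g₀ os).shA
        (cr F θ hP g₀ os).shB Wsh)
    (h19 : ∀ (F : T4Family) (θ : Stage13Params F N) (hP : θ.Provisos₁₃Core F N), θ.Admissible F N → ∀ (g₀ : ℕ → ℝ) (os : List (ULoop F))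
      (h : IsDatumOfRecord₁₃CCoP F N (datumOfRecord₁₃CoP F N θ hP)) (k : ℕ),
      RatesAt (datumOfRecord₁₃CoP F N θ hP) (rateCarriersOfRecord₁₃CoP 𝔯 F h.params h.provisos g₀ os k) → letI := (cr F θ hP g₀ os).dec
        ∃ δ : ℕ → ℝ, NE7.Core (cr F θ hP g₀ os).l₀ (cr F θ hP g₀ os).vol (cr F θ hP g₀ os).T (cr F θ hP g₀ os).Bad
          (fun K t τ => (cr F θ hP g₀ os).A K t τ - (cr F θ hP g₀ os).shA K t τ) (fun K t τ => (cr F θ hP g₀ os).B K t τ - (cr F θ hP g₀ os).shB K t τ) δ ∧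
          Summable δ) :
    Spine (N := N) fun F D w => IsRecordOfRecord₁₃CCoP F N D w :=
  spine_rec13CCoP_of_homes₁₃CoP_existsShellWeight cr 𝔯 h14 h15 h16 h17 h18 h22 (s_N27x_sRec₁₃CoP_of cr hx) ((s_N20_sRec₁₃CoP_iff cr).2 h20) hW h19

end Summit.QuantumFields.YangMills.Theorems.N21AtSRec13CoPWeightHomes
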